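import Summits.Ventures.Crystal3D.Theorems.StickyWulffConstantPolycrystalWulffBoundCert3Assembly
import Summits.Ventures.Crystal3D.Theorems.StickyWulffConstantPolycrystalWulffBoundCert3StaticRows
import Summits.Ventures.Crystal3D.Theorems.StickyWulffConstantPolycrystalWulffBoundWallRow
import Summits.Ventures.Crystal3D.Theorems.StickyWulffConstantPolycrystalWulffBoundRecolourMove
import Summits.Ventures.Crystal3D.Theorems.StickyWulffConstantPolycrystalWulffBoundVertexShaving
import Summits.Ventures.Crystal3D.Theorems.StickyWulffConstantPolycrystalWulffBoundWulffOverlapHyps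
import Summits.Ventures.Crystal3D.Theorems.StickyWulffConstantPolycrystalWulffBoundRungSameLattice

/-!
# `PolycrystalWulffBound`, line `PolyDensity`: twin-free textures with THREE lattice classes

Route `StickyWulffConstant` of the venture `Summits/Ventures/Crystal3D`, crux `PolycrystalWulffBound`
(item `stmt-Ventures-19482`), second prover lane (poly-p2, gen 4).  The BRIDGE from a twin-free polyhedral
texture whose grains carry three (sorted) lattice classes to the typed LP certificate `cert3_k278`
(`…Cert3Assembly`, 41 boxes at the pair overlap constant `27.8`): `threeClass_core` — given three
representatives `a, b, d` with pairwise distinct lattices covering all grains and class volumes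
`v(a) ≥ v(b) ≥ v(d)`, `v(a) ≤ (17/20)·Vol`, and `∀ R, 27.8 ≤ |W(1) ∩ W(R)|`, the polycrystal Wulff bound
holds.  Rows: `classBlock_row` (pair/triple/shaved bodies; `wulffTripleOverlap_of_pair`,
`toReal_volume_inter_closedBall_ge`), floors, iso — all via `threeClass_staticRows` — then `walls_ge_crossClass`,
`recolour_move` + `rung_twinFree_twoClasses_of_overlap` / `rung_sameLattice`.
WHAT THIS IS NOT: the sorted/dominant/two-class case split (next file); F-C1 not moved.
-/

noncomputable section

open scoped BigOperators InnerProductSpace ENNReal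
open MeasureTheory Filter

namespace Summit.Ventures.Crystal3D.Cruxes.PolycrystalWulffBound.PolyDensity

open Summit.Ventures.Crystal3D.Theorems
open Summit.Ventures.Crystal3D.Cruxes.TextureLiminf.TexShadow (per polytope E3)
open Literature.MathematicalPhysics.StatisticalMechanics (perimeter)

set_option maxHeartbeats 4000000 in  -- one long assembly proof (≈ 20 rows + certificate)
/-- **Three sorted classes, core bound.**  See the module docstring. -/
theorem threeClass_core :
    let Λ : Set (EuclideanSpace ℝ (Fin 3)) := Literature.MathematicalPhysics.StatisticalMechanics.fccStacking 1 (Real.sqrt (2 / 3));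
    let Brl : (ℤ → ℤ) → Set (EuclideanSpace ℝ (Fin 3)) := Literature.MathematicalPhysics.StatisticalMechanics.barlowStacking 1 (Real.sqrt (2 / 3));
    let Ax : EuclideanSpace ℝ (Fin 3) → (EuclideanSpace ℝ (Fin 3) ≃ₗᵢ[ℝ] EuclideanSpace ℝ (Fin 3)) → (EuclideanSpace ℝ (Fin 3) ≃ₗᵢ[ℝ] EuclideanSpace ℝ (Fin 3)) → Prop := fun m A B => ∃ (L : EuclideanSpace ℝ (Fin 3) ≃ₗᵢ[ℝ] EuclideanSpace ℝ (Fin 3)) (s₁ s₂ : EuclideanSpace ℝ (Fin 3)) (σ σ' : ℤ → ℤ), Literature.MathematicalPhysics.StatisticalMechanics.IsHaggSeq σ ∧ Literature.MathematicalPhysics.StatisticalMechanics.IsHaggSeq σ' ∧ L (EuclideanSpace.single (2 : Fin 3) (1 : ℝ)) = m ∧ A '' Λ ⊆ (fun q => L q + s₁) '' Brl σ ∧ B '' Λ ⊆ (fun q => L q + s₂) '' Brl σ';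
    let CoAx : (EuclideanSpace ℝ (Fin 3) ≃ₗᵢ[ℝ] EuclideanSpace ℝ (Fin 3)) → (EuclideanSpace ℝ (Fin 3) ≃ₗᵢ[ℝ] EuclideanSpace ℝ (Fin 3)) → Prop := fun A B => ∃ m, Ax m A B;
    let Φ : EuclideanSpace ℝ (Fin 3) → ℝ := fun ν => Real.sqrt 2 / 4 * ∑ᶠ w ∈ {w ∈ Λ | ‖w‖ = 1}, |⟪w, ν⟫_ℝ|;
    let Per : Set (EuclideanSpace ℝ (Fin 3)) → Set (EuclideanSpace ℝ (Fin 3)) → ℝ := fun K S => (⨆ (ξ : EuclideanSpace ℝ (Fin 3) → EuclideanSpace ℝ (Fin 3)) (_ : ContDiff ℝ 1 ξ ∧ HasCompactSupport ξ ∧ ∀ z, ξ z ∈ K), ENNReal.ofReal (∫ z in S, Literature.MathematicalPhysics.StatisticalMechanics.fieldDivergence ξ z)).toReal;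
    let ι : Set (EuclideanSpace ℝ (Fin 3)) → Set (EuclideanSpace ℝ (Fin 3)) → Set (EuclideanSpace ℝ (Fin 3)) → ℝ := fun K S₁ S₂ => (Per K S₁ + Per K S₂ - Per K (S₁ ∪ S₂)) / 2;
    let W : (EuclideanSpace ℝ (Fin 3) ≃ₗᵢ[ℝ] EuclideanSpace ℝ (Fin 3)) → Set (EuclideanSpace ℝ (Fin 3)) := fun A => {y | ∀ ν : EuclideanSpace ℝ (Fin 3), ⟪y, ν⟫_ℝ ≤ Φ (A.symm ν)};
    let Dsc : EuclideanSpace ℝ (Fin 3) → Set (EuclideanSpace ℝ (Fin 3)) := fun m => {y | ‖y‖ ≤ 1 ∧ ⟪y, m⟫_ℝ = 0};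
    let Tex : (n : ℕ) → (Fin n → Set (EuclideanSpace ℝ (Fin 3))) → (Fin n → (EuclideanSpace ℝ (Fin 3) ≃ₗᵢ[ℝ] EuclideanSpace ℝ (Fin 3))) → (Fin n → Fin n → ℝ) → (Fin n → Fin n → EuclideanSpace ℝ (Fin 3)) → Prop := fun n G A c m => (∀ f : Fin n, Literature.MathematicalPhysics.StatisticalMechanics.HasFinitePerimeter (G f) ∧ volume (G f) < ⊤) ∧ (∀ f g, f ≠ g → Disjoint (G f) (G g)) ∧ (∀ f g, f ≠ g → 0 ≤ c f g) ∧ (∀ f g, f ≠ g → ¬ CoAx (A f) (A g) → m f g = 0 ∧ 1 ≤ c f g) ∧ (∀ f g, f ≠ g → CoAx (A f) (A g) → A f '' Λ ≠ A g '' Λ → Ax (m f g) (A f) (A g) ∧ 1 / 2 ≤ c f g);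
    let En : (n : ℕ) → (Fin n → Set (EuclideanSpace ℝ (Fin 3))) → (Fin n → (EuclideanSpace ℝ (Fin 3) ≃ₗᵢ[ℝ] EuclideanSpace ℝ (Fin 3))) → (Fin n → Fin n → ℝ) → (Fin n → Fin n → EuclideanSpace ℝ (Fin 3)) → ℝ := fun n G A c m => ∑ f : Fin n, Per (W (A f)) (G f) - ∑ f, ∑ g, (if f = g then 0 else ι (W (A f)) (G f) (G g)) + ∑ f, ∑ g, (if f = g then 0 else c f g / 2 * ι (Dsc (m f g)) (G f) (G g));
    let Vol : (n : ℕ) → (Fin n → Set (EuclideanSpace ℝ (Fin 3))) → ℝ := fun n G => (volume (⋃ f : Fin n, G f)).toReal;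
    let Poly : Set (EuclideanSpace ℝ (Fin 3)) → Prop := fun S => ∃ (k : ℕ) (H : Fin k → Finset ((EuclideanSpace ℝ (Fin 3)) × ℝ)), S = ⋃ i, ⋂ p ∈ H i, {x | ⟪p.1, x⟫_ℝ < p.2};
    let TF : (n : ℕ) → (Fin n → (EuclideanSpace ℝ (Fin 3) ≃ₗᵢ[ℝ] EuclideanSpace ℝ (Fin 3))) → Prop := fun n A => ∀ f g : Fin n, f ≠ g → CoAx (A f) (A g) → A f '' Λ = A g '' Λ;
    ∀ (n : ℕ) (G : Fin n → Set (EuclideanSpace ℝ (Fin 3))) (A : Fin n → (EuclideanSpace ℝ (Fin 3) ≃ₗᵢ[ℝ] EuclideanSpace ℝ (Fin 3))) (c : Fin n → Fin n → ℝ) (m : Fin n → Fin n → EuclideanSpace ℝ (Fin 3))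
      (a b d : Fin n), Tex n G A c m → (∀ f, Poly (G f)) → TF n A →
      A a '' Λ ≠ A b '' Λ → A b '' Λ ≠ A d '' Λ → A a '' Λ ≠ A d '' Λ →
      (∀ f, A f '' Λ = A a '' Λ ∨ A f '' Λ = A b '' Λ ∨ A f '' Λ = A d '' Λ) →
      (volume (⋃ f ∈ Finset.univ.filter (fun f => A f '' Λ = A d '' Λ), G f)).toReal ≤
        (volume (⋃ f ∈ Finset.univ.filter (fun f => A f '' Λ = A b '' Λ), G f)).toReal →
      (volume (⋃ f ∈ Finset.univ.filter (fun f => A f '' Λ = A b '' Λ), G f)).toReal ≤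
        (volume (⋃ f ∈ Finset.univ.filter (fun f => A f '' Λ = A a '' Λ), G f)).toReal →
      (volume (⋃ f ∈ Finset.univ.filter (fun f => A f '' Λ = A a '' Λ), G f)).toReal ≤ 17 / 20 * Vol n G →
      0 < Vol n G →
      (∀ R : EuclideanSpace ℝ (Fin 3) ≃ₗᵢ[ℝ] EuclideanSpace ℝ (Fin 3), (27.8 : ℝ) ≤ (volume (W (LinearIsometryEquiv.refl ℝ (EuclideanSpace ℝ (Fin 3))) ∩ W R)).toReal) →
      6 * (2 : ℝ) ^ ((1 : ℝ) / 3) * (Real.sqrt 2 * Vol n G) ^ ((2 : ℝ) / 3) ≤ En n G A c m := by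
  intro Λ Brl Ax CoAx Φ Per ι W Dsc Tex En Vol Poly TF n G A c m a b d hTex hPoly hTF hab hbd had hcover
    hdb hba hdom hVpos hOv
  classical
  obtain ⟨hfin, hdisj, hc0, hgen, hco⟩ := hTex
  have hvol : ∀ f, volume (G f) < ⊤ := fun f => (hfin f).2
  set lat : Fin n → Set E3 := fun f => A f '' Λ with hlat
  set rep : Fin 3 → Fin n := ![a, b, d] with hrep
  have hrep0 : rep 0 = a := rfl
  have hrep1 : rep 1 = b := rfl
  have hrep2 : rep 2 = d := rfl
  set cls : Fin n → Fin 3 := fun f => if lat f = lat a then 0 else if lat f = lat b then 1 else 2 with hcls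
  have hcls_rep : ∀ f, lat f = lat (rep (cls f)) := by
    intro f
    by_cases h0 : lat f = lat a
    · have hc : cls f = 0 := by
        show (if lat f = lat a then (0 : Fin 3) else if lat f = lat b then 1 else 2) = 0; rw [if_pos h0]
      rw [hc]; exact h0
    · by_cases h1 : lat f = lat b
      · have hc : cls f = 1 := by
          show (if lat f = lat a then (0 : Fin 3) else if lat f = lat b then 1 else 2) = 1
          rw [if_neg h0, if_pos h1]
        rw [hc]; exact h1
      · have hc : cls f = 2 := by
          show (if lat f = lat a then (0 : Fin 3) else if lat f = lat b then 1 else 2) = 2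
          rw [if_neg h0, if_neg h1]
        rw [hc]
        rcases hcover f with h | h | h
        · exact absurd h h0
        · exact absurd h h1
        · exact h
  have hcls_iff : ∀ f g, cls f = cls g ↔ A f '' Λ = A g '' Λ := by
    intro f g
    constructor
    · intro h
      show lat f = lat g
      rw [hcls_rep f, hcls_rep g, h]
    · intro h
      change lat f = lat g at h
      show (if lat f = lat a then (0 : Fin 3) else if lat f = lat b then 1 else 2) =
        (if lat g = lat a then (0 : Fin 3) else if lat g = lat b then 1 else 2)
      rw [h]
  have hcls_a : cls a = 0 := by
    show (if lat a = lat a then (0 : Fin 3) else if lat a = lat b then 1 else 2) = 0; rw [if_pos rfl]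
  have hcls_b : cls b = 1 := by
    show (if lat b = lat a then (0 : Fin 3) else if lat b = lat b then 1 else 2) = 1
    rw [if_neg (fun h => hab h.symm), if_pos rfl]
  have hcls_d : cls d = 2 := by
    show (if lat d = lat a then (0 : Fin 3) else if lat d = lat b then 1 else 2) = 2
    rw [if_neg (fun h => had h.symm), if_neg (fun h => hbd h.symm)]
  have hcls_of_rep : ∀ i, cls (rep i) = i := by
    intro i; fin_cases i
    · exact hcls_a
    · exact hcls_b
    · exact hcls_d
  have hC : ∀ i, Finset.univ.filter (fun f => cls f = i) = Finset.univ.filter (fun f => lat f = lat (rep i)) := by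
    intro i; ext f
    simp only [Finset.mem_filter, Finset.mem_univ, true_and]
    constructor
    · intro h; rw [hcls_rep f, h]
    · intro h
      have h' : cls f = cls (rep i) := (hcls_iff f (rep i)).2 h
      rw [h', hcls_of_rep]
  set KC : Fin 3 → Set E3 := fun i => W (A (rep i)) with hKC
  have hWcls : ∀ f, W (A f) = KC (cls f) := fun f => wulffBody_eq_of_image_eq (hcls_rep f)
  have hKc : ∀ i, IsCompact (KC i) := fun i => isCompact_cruxWulffBody _
  have hKv : ∀ i, Convex ℝ (KC i) := fun i => convex_cruxWulffBody _
  have hK0 : ∀ i, (0 : E3) ∈ KC i := fun i => zero_mem_cruxWulffBody _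
  have hKs : ∀ i, -KC i = KC i := fun i => neg_cruxWulffBody_eq _
  have hK3 : ∀ i, Metric.closedBall (0 : E3) (Real.sqrt 3) ⊆ KC i := fun i =>
    closedBall_subset_cruxWulffBody _
  have hK5 : ∀ i, KC i ⊆ Metric.closedBall (0 : E3) (Real.sqrt 5) := fun i =>
    cruxWulffBody_subset_closedBall _
  have hKm : ∀ i, MeasurableSet (KC i) := fun i => (hKc i).measurableSet
  have hvolK : ∀ i, (volume (KC i)).toReal = 32 := by
    intro i; show (volume (W (A (rep i)))).toReal = 32
    rw [volume_cruxWulffBody]; simp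
  have hpair : ∀ i j, (27.8 : ℝ) ≤ (volume (KC i ∩ KC j)).toReal := by
    intro i j
    set I : EuclideanSpace ℝ (Fin 3) ≃ₗᵢ[ℝ] EuclideanSpace ℝ (Fin 3) :=
      LinearIsometryEquiv.refl ℝ (EuclideanSpace ℝ (Fin 3)) with hI
    set R : EuclideanSpace ℝ (Fin 3) ≃ₗᵢ[ℝ] EuclideanSpace ℝ (Fin 3) :=
      (A (rep j)).trans (A (rep i)).symm with hR
    have h1 : W (A (rep i)) = A (rep i) '' W I := cruxWulffBody_eq_image_self (A (rep i))
    have h2 : W (A (rep j)) = A (rep j) '' W I := cruxWulffBody_eq_image_self (A (rep j))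
    have h3 : W R = R '' W I := cruxWulffBody_eq_image_self R
    have hcomp : (A (rep i) : EuclideanSpace ℝ (Fin 3) → EuclideanSpace ℝ (Fin 3)) ∘ R = A (rep j) := by
      ext x; simp [hR]
    have hset : W (A (rep i)) ∩ W (A (rep j)) = A (rep i) '' (W I ∩ W R) := by
      rw [Set.image_inter (A (rep i)).injective, ← h1, h3, ← Set.image_comp, hcomp, ← h2]
    have hmeas : MeasurableSet (W I ∩ W R) :=
      ((isCompact_cruxWulffBody I).inter (isCompact_cruxWulffBody R)).measurableSet
    have hv : volume (W (A (rep i)) ∩ W (A (rep j))) = volume (W I ∩ W R) := by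
      rw [hset, LinearIsometryEquiv.image_eq_preimage_symm,
        (A (rep i)).symm.measurePreserving.measure_preimage hmeas.nullMeasurableSet]
    show (27.8 : ℝ) ≤ (volume (W (A (rep i)) ∩ W (A (rep j)))).toReal
    rw [hv]; exact hOv R
  have htriple : (23.6 : ℝ) ≤ (volume (KC 0 ∩ KC 1 ∩ KC 2)).toReal := by
    have h := toReal_volume_inter_inter_ge (hKm 0) (hKm 2) (volume_cruxWulffBody (A (rep 0)))
      (hpair 0 1) (hpair 0 2)
    norm_num at h ⊢; exact h
  have hshave : ∀ i (K : Set E3), K ⊆ KC i → ∀ ε : ℝ, 0 < ε → ε ≤ 5 →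
      (volume K).toReal - 8 * ε ^ 3 ≤ (volume (K ∩ Metric.closedBall (0 : E3) (Real.sqrt (5 - ε)))).toReal :=
    fun i K hK ε hε hε5 => toReal_volume_inter_closedBall_ge (A (rep i)) hK hε hε5
  obtain ⟨F, Y, Acl, v, hFdef, hYdef, hAcldef, hvdef, hV, hv_nn, hF_nn, hY_nn, hAcl_nn, hAcl_symm, h_floor1, h_floor2,
    h_block_0__1_, h_block_0__1__2_, h_shv0_2_0__1_, h_shv0_2_0__2_, h_shv0_3_0__, h_shv0_3_1__, h_shv0_4_0__,
    h_shv0_4_1__, h_shv0_4_2__, h_shv0_5_2__, h_iso_2__⟩ :=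
    threeClass_staticRows G hfin hPoly hdisj cls KC hKc hKv hK0 hKs hK3 hK5 hvolK hpair htriple hshave
  set C : Fin 3 → Finset (Fin n) := fun i => Finset.univ.filter (fun f => cls f = i) with hCdef
  have hva : v 0 = (volume (⋃ f ∈ Finset.univ.filter (fun f => A f '' Λ = A a '' Λ), G f)).toReal := by
    rw [hvdef]; show (volume (⋃ f ∈ Finset.univ.filter (fun f => cls f = 0), G f)).toReal = _
    rw [show Finset.univ.filter (fun f => cls f = 0) = _ from hC 0]; rfl
  have hvb : v 1 = (volume (⋃ f ∈ Finset.univ.filter (fun f => A f '' Λ = A b '' Λ), G f)).toReal := by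
    rw [hvdef]; show (volume (⋃ f ∈ Finset.univ.filter (fun f => cls f = 1), G f)).toReal = _
    rw [show Finset.univ.filter (fun f => cls f = 1) = _ from hC 1]; rfl
  have hvd : v 2 = (volume (⋃ f ∈ Finset.univ.filter (fun f => A f '' Λ = A d '' Λ), G f)).toReal := by
    rw [hvdef]; show (volume (⋃ f ∈ Finset.univ.filter (fun f => cls f = 2), G f)).toReal = _
    rw [show Finset.univ.filter (fun f => cls f = 2) = _ from hC 2]; rfl
  rw [← hva] at hba hdom; rw [← hvb] at hdb hba; rw [← hvd] at hdb
  have h17 : (1.73205 : ℝ) ≤ Real.sqrt 3 := by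
    rw [show (1.73205 : ℝ) = Real.sqrt (1.73205 ^ 2) by rw [Real.sqrt_sq (by norm_num)]]
    exact Real.sqrt_le_sqrt (by norm_num)
  have hsq5 : Real.sqrt 5 ≤ 2.23607 := by
    rw [show (2.23607 : ℝ) = Real.sqrt (2.23607 ^ 2) by rw [Real.sqrt_sq (by norm_num)]]
    exact Real.sqrt_le_sqrt (by norm_num)
  have hS12 : ∀ (φ : Fin 3 → ℝ), (∑ i ∈ ({1, 2} : Finset (Fin 3)), φ i) = φ 1 + φ 2 := fun φ =>
    Finset.sum_pair (by decide)
  have hwalls := walls_ge_crossClass n G A c m (Fin 3) cls ⟨hfin, hdisj, hc0, hgen, hco⟩ hPoly hTF hcls_iff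
  have hne01 : (0 : Fin 3) ≠ 1 := by decide
  have hne02 : (0 : Fin 3) ≠ 2 := by decide
  have hne12 : (1 : Fin 3) ≠ 2 := by decide
  have hne10 : (1 : Fin 3) ≠ 0 := by decide
  have hne20 : (2 : Fin 3) ≠ 0 := by decide
  have hne21 : (2 : Fin 3) ≠ 1 := by decide
  have hfibg : ∀ (ψ : Fin n → ℝ), (∑ g, ψ g) = ∑ j : Fin 3, ∑ g ∈ C j, ψ g := fun ψ =>
    (Finset.sum_fiberwise_of_maps_to (s := Finset.univ) (t := Finset.univ) (g := cls)
      (fun _ _ => Finset.mem_univ _) ψ).symm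
  have hfib : ∀ φ : Fin n → Fin n → ℝ, (∑ f, ∑ g, φ f g) = ∑ i : Fin 3, ∑ j : Fin 3, ∑ f ∈ C i, ∑ g ∈ C j, φ f g := by
    intro φ
    rw [hfibg (fun f => ∑ g, φ f g)]
    refine Finset.sum_congr rfl fun i _ => ?_
    rw [show (∑ f ∈ C i, ∑ g, φ f g) = ∑ f ∈ C i, ∑ j : Fin 3, ∑ g ∈ C j, φ f g from
      Finset.sum_congr rfl fun f _ => hfibg (φ f), Finset.sum_comm]
  have hblockP : ∀ (P : Fin 3 → Fin 3 → Prop) [∀ i j, Decidable (P i j)] (i j : Fin 3),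
      (∑ f ∈ C i, ∑ g ∈ C j, (if f ≠ g ∧ P (cls f) (cls g) ∧ cls f ≠ cls g then
        ι (Metric.closedBall (0 : EuclideanSpace ℝ (Fin 3)) 1) (G f) (G g) / 2 else 0)) =
      if P i j ∧ i ≠ j then Acl i j / 2 else 0 := by
    intro P _ i j
    by_cases hP : P i j ∧ i ≠ j
    · rw [if_pos hP]; simp only [hAcldef, Finset.sum_div]
      refine Finset.sum_congr rfl fun f hf => Finset.sum_congr rfl fun g hg => ?_
      have hcf := (Finset.mem_filter.1 hf).2; have hcg := (Finset.mem_filter.1 hg).2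
      have hfg : f ≠ g := fun h => hP.2 (by rw [← hcf, ← hcg, h])
      rw [if_pos ⟨hfg, by rw [hcf, hcg]; exact hP.1, by rw [hcf, hcg]; exact hP.2⟩]; rfl
    · rw [if_neg hP]
      refine Finset.sum_eq_zero fun f hf => Finset.sum_eq_zero fun g hg => ?_
      have hcf := (Finset.mem_filter.1 hf).2; have hcg := (Finset.mem_filter.1 hg).2
      rw [if_neg]; rintro ⟨-, h1, h2⟩; exact hP ⟨by rw [← hcf, ← hcg]; exact h1, by rw [← hcf, ← hcg]; exact h2⟩
  have hcross : (∑ f, ∑ g, (if cls f ≠ cls g then ι (Metric.closedBall (0 : EuclideanSpace ℝ (Fin 3)) 1) (G f) (G g) / 2 else 0)) =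
      Acl 0 1 + Acl 0 2 + Acl 1 2 := by
    have h1 : (∑ f, ∑ g, (if cls f ≠ cls g then ι (Metric.closedBall (0 : EuclideanSpace ℝ (Fin 3)) 1) (G f) (G g) / 2 else 0)) =
        ∑ f, ∑ g, (if f ≠ g ∧ True ∧ cls f ≠ cls g then
          ι (Metric.closedBall (0 : EuclideanSpace ℝ (Fin 3)) 1) (G f) (G g) / 2 else 0) := by
      refine Finset.sum_congr rfl fun f _ => Finset.sum_congr rfl fun g _ => ?_
      by_cases h : cls f ≠ cls g
      · have hfg : f ≠ g := fun e => h (by rw [e])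
        rw [if_pos h, if_pos ⟨hfg, trivial, h⟩]
      · rw [if_neg h, if_neg (fun k => h k.2.2)]
    rw [h1, hfib, Finset.sum_congr rfl (fun i _ => Finset.sum_congr rfl (fun j _ => hblockP (fun _ _ => True) i j))]
    norm_num [Fin.sum_univ_three, hne01, hne02, hne12, hne10, hne20, hne21]
    linarith [hAcl_symm 1 0, hAcl_symm 2 0, hAcl_symm 2 1]
  have hFsum : (∑ f, (Per (W (A f)) (G f) - ∑ g, (if f = g then 0 else ι (W (A f)) (G f) (G g)))) = F 0 + F 1 + F 2 := by
    have hfr : ∀ f, (Per (W (A f)) (G f) - ∑ g, (if f = g then 0 else ι (W (A f)) (G f) (G g))) =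
        per (KC (cls f)) (G f) - ∑ g, (if f = g then 0 else
          (per (KC (cls f)) (G f) + per (KC (cls f)) (G g) - per (KC (cls f)) (G f ∪ G g)) / 2) := by
      intro f; rw [hWcls f]; rfl
    simp only [hfr, hFdef]
    rw [← Finset.sum_fiberwise_of_maps_to (s := Finset.univ) (t := Finset.univ) (g := cls) (fun _ _ => Finset.mem_univ _),
      Fin.sum_univ_three]
  have hEn : En n G A c m = (F 0 + F 1 + F 2) +
      ∑ f, ∑ g, (if f = g then 0 else c f g / 2 * ι (Dsc (m f g)) (G f) (G g)) := by
    show (∑ f, Per (W (A f)) (G f) - ∑ f, ∑ g, (if f = g then 0 else ι (W (A f)) (G f) (G g)) +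
        ∑ f, ∑ g, (if f = g then 0 else c f g / 2 * ι (Dsc (m f g)) (G f) (G g))) = _
    rw [← hFsum, Finset.sum_sub_distrib]
  have h_E__F_A : 0 ≤ (1 : ℝ) * En n G A c m + (-1 : ℝ) * F 0 + (-1 : ℝ) * F 1 + (-1 : ℝ) * F 2 + (-1 : ℝ) * Acl 0 1 + (-1 : ℝ) * Acl 0 2 + (-1 : ℝ) * Acl 1 2 := by
    rw [hcross] at hwalls; rw [hEn]; linarith
  have ha_disc : Real.sqrt 5 - Real.sqrt 3 ≤ 0.50402 := by linarith [hsq5, h17]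
  have hOv' : ∀ R : EuclideanSpace ℝ (Fin 3) ≃ₗᵢ[ℝ] EuclideanSpace ℝ (Fin 3),
      (27.5 : ℝ) ≤ (volume (W (LinearIsometryEquiv.refl ℝ (EuclideanSpace ℝ (Fin 3))) ∩ W R)).toReal :=
    fun R => le_trans (by norm_num) (hOv R)
  have hYS : ∀ S : Finset (Fin 3), (∑ f ∈ Finset.univ.filter (fun f => cls f ∈ S),
      (Per (Metric.closedBall (0 : EuclideanSpace ℝ (Fin 3)) 1) (G f) -
        ∑ g, (if f = g then 0 else ι (Metric.closedBall (0 : EuclideanSpace ℝ (Fin 3)) 1) (G f) (G g)))) =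
      ∑ i ∈ S, Y i := by
    intro S
    rw [← Finset.sum_fiberwise_of_maps_to (g := cls) (t := S) (fun f hf => (Finset.mem_filter.1 hf).2)]
    simp only [hYdef]
    refine Finset.sum_congr rfl fun i hi => ?_
    refine Finset.sum_congr ?_ fun f _ => rfl
    ext f; simp only [Finset.mem_filter, Finset.mem_univ, true_and]
    exact ⟨fun h => h.2, fun h => ⟨h ▸ hi, h⟩⟩
  have hAint : ∀ (P : Fin 3 → Prop) [DecidablePred P],
      (∑ f, ∑ g, (if f ≠ g ∧ P (cls f) ∧ P (cls g) ∧ cls f ≠ cls g then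
        ι (Metric.closedBall (0 : EuclideanSpace ℝ (Fin 3)) 1) (G f) (G g) / 2 else 0)) =
      ∑ i : Fin 3, ∑ j : Fin 3, (if (P i ∧ P j) ∧ i ≠ j then Acl i j / 2 else 0) := by
    intro P _
    have h1 : (∑ f, ∑ g, (if f ≠ g ∧ P (cls f) ∧ P (cls g) ∧ cls f ≠ cls g then
        ι (Metric.closedBall (0 : EuclideanSpace ℝ (Fin 3)) 1) (G f) (G g) / 2 else 0)) =
        ∑ f, ∑ g, (if f ≠ g ∧ (P (cls f) ∧ P (cls g)) ∧ cls f ≠ cls g then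
          ι (Metric.closedBall (0 : EuclideanSpace ℝ (Fin 3)) 1) (G f) (G g) / 2 else 0) := by
      refine Finset.sum_congr rfl fun f _ => Finset.sum_congr rfl fun g _ => ?_
      simp only [and_assoc]
    rw [h1, hfib]
    exact Finset.sum_congr rfl (fun i _ => Finset.sum_congr rfl (fun j _ => hblockP (fun i j => P i ∧ P j) i j))
  have hrec_one : ∀ (ℓ₀ : Fin n) (t : Fin 3), cls ℓ₀ = t → (t = 0 ∨ t = 1) →
      6 * (2 : ℝ) ^ ((1 : ℝ) / 3) * (Real.sqrt 2 * Vol n G) ^ ((2 : ℝ) / 3) ≤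
        En n G A c m + (Real.sqrt 5 - Real.sqrt 3) * Y 2 - Acl t 2 := by
    intro ℓ₀ t ht ht01
    have ht2 : t ≠ 2 := by rcases ht01 with rfl | rfl <;> decide
    have hℓ₀S : ℓ₀ ∉ C 2 := by simp [hCdef, ht, ht2]
    have hS : ∀ f g : Fin n, cls f = cls g → f ∈ C 2 → g ∈ C 2 := by
      intro f g hfg hf; simp only [hCdef, Finset.mem_filter, Finset.mem_univ, true_and] at hf ⊢; rw [← hfg, hf]
    have hmv := recolour_move n G A c m (Fin 3) cls (C 2) ℓ₀ ⟨hfin, hdisj, hc0, hgen, hco⟩ hPoly hTF hcls_iff hS hℓ₀S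
    obtain ⟨hTex', hTF', hineq⟩ := hmv
    -- the recoloured texture has at most two classes
    set A' : Fin n → (EuclideanSpace ℝ (Fin 3) ≃ₗᵢ[ℝ] EuclideanSpace ℝ (Fin 3)) :=
      fun f => if f ∈ C 2 then A ℓ₀ else A f with hA'
    have hlat' : ∀ f, A' f '' Λ = lat a ∨ A' f '' Λ = lat b := by
      intro f
      by_cases hf : f ∈ C 2
      · have : A' f = A ℓ₀ := by simp [hA', hf]
        rw [this]
        have hl := hcls_rep ℓ₀; rw [ht] at hl
        rcases ht01 with rfl | rfl
        · exact Or.inl hl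
        · exact Or.inr hl
      · have : A' f = A f := by simp [hA', hf]
        rw [this]
        have hcf : cls f ≠ 2 := fun h => hf (by simp [hCdef, h])
        have hl := hcls_rep f
        have : cls f = 0 ∨ cls f = 1 := by
          rcases Fin.exists_fin_succ.mp ⟨cls f, rfl⟩ with h | ⟨j, hj⟩ <;> omega
        rcases this with h | h
        · rw [h] at hl; exact Or.inl hl
        · rw [h] at hl; exact Or.inr hl
    have hTwo' : ∀ f g h : Fin n, A' f '' Λ = A' g '' Λ ∨ A' g '' Λ = A' h '' Λ ∨ A' f '' Λ = A' h '' Λ := by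
      intro f g h
      rcases hlat' f with hf | hf <;> rcases hlat' g with hg | hg <;> rcases hlat' h with hh | hh <;>
        first | exact Or.inl (hf.trans hg.symm) | exact Or.inr (Or.inl (hg.trans hh.symm)) |
          exact Or.inr (Or.inr (hf.trans hh.symm))
    have hbound := rung_twinFree_twoClasses_of_overlap n G A' _ m hTex' hPoly hTF' hTwo' hOv'
    -- identify Y_S and A_int
    have hY2 := hYS {2}
    have hset2 : Finset.univ.filter (fun f => cls f ∈ ({2} : Finset (Fin 3))) = C 2 := by ext f; simp [hCdef]
    rw [hset2, Finset.sum_singleton] at hY2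
    have hP : (∑ f, ∑ g, (if f ≠ g ∧ (f ∈ C 2 ∨ cls f = cls ℓ₀) ∧ (g ∈ C 2 ∨ cls g = cls ℓ₀) ∧ cls f ≠ cls g then
        ι (Metric.closedBall (0 : EuclideanSpace ℝ (Fin 3)) 1) (G f) (G g) / 2 else 0)) = Acl t 2 := by
      have hmem : ∀ f, (f ∈ C 2 ∨ cls f = cls ℓ₀) ↔ (cls f = 2 ∨ cls f = t) := by
        intro f; simp [hCdef, ht]
      have h1 := hAint (fun i => i = 2 ∨ i = t)
      simp only [← hmem] at h1
      rw [h1]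
      rcases ht01 with rfl | rfl
      · norm_num [Fin.sum_univ_three, hne01, hne02, hne12, hne10, hne20, hne21]; linarith [hAcl_symm 2 0]
      · norm_num [Fin.sum_univ_three, hne01, hne02, hne12, hne10, hne20, hne21]; linarith [hAcl_symm 2 1]
    rw [hP, hY2] at hineq
    linarith
  have h_rec_2____0 : 6 * (2 : ℝ) ^ ((1 : ℝ) / 3) * (Real.sqrt 2 * Vol n G) ^ ((2 : ℝ) / 3) ≤ (1 : ℝ) * En n G A c m + ((25201 : ℝ) / 50000) * Y 2 + (-1 : ℝ) * Acl 0 2 := by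
    have h := hrec_one a 0 hcls_a (Or.inl rfl)
    have := mul_le_mul_of_nonneg_right ha_disc (hY_nn 2)
    norm_num at h this ⊢; linarith
  have h_rec_2____1 : 6 * (2 : ℝ) ^ ((1 : ℝ) / 3) * (Real.sqrt 2 * Vol n G) ^ ((2 : ℝ) / 3) ≤ (1 : ℝ) * En n G A c m + ((25201 : ℝ) / 50000) * Y 2 + (-1 : ℝ) * Acl 1 2 := by
    have h := hrec_one b 1 hcls_b (Or.inr rfl)
    have := mul_le_mul_of_nonneg_right ha_disc (hY_nn 2)
    norm_num at h this ⊢; linarith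
  have h_rec_1__2___0 : 6 * (2 : ℝ) ^ ((1 : ℝ) / 3) * (Real.sqrt 2 * Vol n G) ^ ((2 : ℝ) / 3) ≤ (1 : ℝ) * En n G A c m + ((25201 : ℝ) / 50000) * Y 1 + ((25201 : ℝ) / 50000) * Y 2 + (-1 : ℝ) * Acl 1 2 + (-1 : ℝ) * Acl 0 1 + (-1 : ℝ) * Acl 0 2 := by
    set S : Finset (Fin n) := Finset.univ.filter (fun f => cls f ∈ ({1, 2} : Finset (Fin 3))) with hSdef
    have haS : a ∉ S := by simp [hSdef, hcls_a]
    have hS : ∀ f g : Fin n, cls f = cls g → f ∈ S → g ∈ S := by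
      intro f g hfg hf; simp only [hSdef, Finset.mem_filter, Finset.mem_univ, true_and] at hf ⊢; rw [← hfg]; exact hf
    have hmv := recolour_move n G A c m (Fin 3) cls S a ⟨hfin, hdisj, hc0, hgen, hco⟩ hPoly hTF hcls_iff hS haS
    obtain ⟨hTex', -, hineq⟩ := hmv
    set A' : Fin n → (EuclideanSpace ℝ (Fin 3) ≃ₗᵢ[ℝ] EuclideanSpace ℝ (Fin 3)) :=
      fun f => if f ∈ S then A a else A f with hA'
    have hsame : ∀ f g, A' f '' Λ = A' g '' Λ := by
      have hall : ∀ f, A' f '' Λ = lat a := by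
        intro f
        by_cases hf : f ∈ S
        · have : A' f = A a := by simp [hA', hf]
          rw [this]
        · have : A' f = A f := by simp [hA', hf]
          rw [this]
          have hcf : cls f = 0 := by
            simp only [hSdef, Finset.mem_filter, Finset.mem_univ, true_and, Finset.mem_insert,
              Finset.mem_singleton, not_or] at hf
            rcases Fin.exists_fin_succ.mp ⟨cls f, rfl⟩ with h | ⟨j, hj⟩ <;> omega
          have hl := hcls_rep f; rw [hcf] at hl; exact hl
      intro f g; rw [hall f, hall g]
    have hbound := rung_sameLattice n G A' _ m hTex' hPoly hsame
    have hY12 := hYS {1, 2}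
    rw [hS12] at hY12
    have hP : (∑ f, ∑ g, (if f ≠ g ∧ (f ∈ S ∨ cls f = cls a) ∧ (g ∈ S ∨ cls g = cls a) ∧ cls f ≠ cls g then
        ι (Metric.closedBall (0 : EuclideanSpace ℝ (Fin 3)) 1) (G f) (G g) / 2 else 0)) =
        Acl 0 1 + Acl 0 2 + Acl 1 2 := by
      have hmem : ∀ f, (f ∈ S ∨ cls f = cls a) ↔ True := by
        intro f; simp only [hSdef, hcls_a, Finset.mem_filter, Finset.mem_univ, true_and, Finset.mem_insert,
          Finset.mem_singleton, iff_true]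
        rcases Fin.exists_fin_succ.mp ⟨cls f, rfl⟩ with h | ⟨j, hj⟩ <;> omega
      have h1 := hAint (fun _ => True)
      have h2 : (∑ f, ∑ g, (if f ≠ g ∧ (f ∈ S ∨ cls f = cls a) ∧ (g ∈ S ∨ cls g = cls a) ∧ cls f ≠ cls g then
          ι (Metric.closedBall (0 : EuclideanSpace ℝ (Fin 3)) 1) (G f) (G g) / 2 else 0)) =
          ∑ f, ∑ g, (if f ≠ g ∧ True ∧ True ∧ cls f ≠ cls g then
            ι (Metric.closedBall (0 : EuclideanSpace ℝ (Fin 3)) 1) (G f) (G g) / 2 else 0) := by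
        refine Finset.sum_congr rfl fun f _ => Finset.sum_congr rfl fun g _ => ?_
        simp only [hmem, true_and]
      rw [h2, h1]
      norm_num [Fin.sum_univ_three, hne01, hne02, hne12, hne10, hne20, hne21]
      linarith [hAcl_symm 1 0, hAcl_symm 2 0, hAcl_symm 2 1]
    rw [hP, hY12] at hineq
    have h1 := mul_le_mul_of_nonneg_right ha_disc (hY_nn 1)
    have h2 := mul_le_mul_of_nonneg_right ha_disc (hY_nn 2)
    norm_num at h1 h2 ⊢; linarith [hbound, hineq, h1, h2]
  have hκ := wulffConstant_le (V := Vol n G) hVpos.le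
  exact cert3_k278 (κV := 6 * (2 : ℝ) ^ ((1 : ℝ) / 3) * (Real.sqrt 2 * Vol n G) ^ ((2 : ℝ) / 3))
    hV hVpos (hv_nn 0) (hv_nn 1) (hv_nn 2) hdb hba hdom (hF_nn 0) (hF_nn 1) (hF_nn 2) (hY_nn 0) (hY_nn 1) (hY_nn 2)
    (hAcl_nn 0 1 (by decide)) (hAcl_nn 0 2 (by decide)) (hAcl_nn 1 2 (by decide)) (by positivity)
    (by norm_num at hκ ⊢; exact hκ)
    h_E__F_A h_block_0__1_ h_block_0__1__2_ h_floor1 h_floor2 h_iso_2__ h_rec_1__2___0 h_rec_2____0 h_rec_2____1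
    h_shv0_2_0__1_ h_shv0_2_0__2_ h_shv0_3_0__ h_shv0_3_1__ h_shv0_4_0__ h_shv0_4_1__ h_shv0_4_2__ h_shv0_5_2__

end Summit.Ventures.Crystal3D.Cruxes.PolycrystalWulffBound.PolyDensity

end
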